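import Literature.Barriers.CriticalPhenomena.PlaquetteWalkHoleRootDefect
import HarnessLib

/-!
# Barrier catalogue (SAWScalingLimit): the hole-root defect of the ring sits at the ROOT plaquette,
not at the FAR CELL — there the Yang–Baxter vertex functional vanishes for every `θ` (a vacuous zero)

Companion of `PlaquetteWalkHoleRootDefect` (the `3 × 3` block `ring8` minus its centre, rooted on the
boundary of the hole at `holeRoot` = the `N` side of the missing centre: the printed Yang–Baxter weights
violate the vertex relation at the root plaquette `(1, 2)`, `vertexFunctional_printed_ring8_ne_zero`).
This file looks at the plaquette ACROSS the hole from the root, the far cell `(1, 0)`: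

* `vertexFunctional_ring8_farCell_mul` — for ARBITRARY weights `W`, phase `t ≠ 0` and coefficients `c`,
  `F_{ring8}(holeRoot; (1,0)) · t⁴ = u₁u₂²v·t⁶·G_W + u₁²u₂v·G_E`, where
  `G_W = c_W t + c_E v t + c_S u₂ + c_N u₁ t²` and `G_E = c_E t + c_W v t + c_S u₁ t² + c_N u₂` are the
  one-plaquette ("group one") forms of a plaquette entered from its `W` / `E` side (kernel enumeration:
  exactly eight walks of the ring from the hole root end on a side of the far cell — four come down the
  left column and enter or stop at its `W` side, four come down the right column; NO walk passes the far
  cell, goes around the hole and returns to it: it would have to cross the root plaquette a second time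
  and leave the ring through its outer side);
* `vertexFunctional_unitW_mul` / `vertexFunctional_unitE_mul` — the same two forms ARE the functionals of
  the one-face lists `[(1,0)]` rooted at their `W` / `E` side (outer roots, `outerRoot_unitW/E`), so by
  the tree's Lemma 2.1 on general domains (`vertexFunctional_printed_eq_zero`) they vanish at the printed
  weights for every `θ ∈ [π/3, 2π/3]` (`groupOneW_printed_eq_zero`, `groupOneE_printed_eq_zero`);
* ★ **`vertexFunctional_printed_ring8_farCell_eq_zero`** — hence for every `θ ∈ [π/3, 2π/3]` the printed
  weights with the Yang–Baxter coefficients `(1, r(θ), −1, −r(θ))` satisfy the vertex relation AT THE FAR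
  CELL of the hole root of the ring: `F_{ring8}(holeRoot; (1,0)) = 0`, although they violate it at the
  root plaquette (`vertexFunctional_printed_ring8_ne_zero`, `θ = π/3`). Named statement
  `PlaquetteWalkHoleRootFarCellZero` / `_holds`.

Why it matters (venture lane «pcv-sawmu», hole-ring census of 2026-08-24): on single-hole BOXES whose
ring around the hole has width `≥ 2` everywhere, the exact far-cell zeros of a hole root at `θ = π/2`
were observed to coincide with the mirror symmetry of the box through the root (24/24 roots), with no
far-cell zero at four other `θ`; the present theorem shows that on THIN rings the far-cell zero is
automatic (no encircling walk reaches the far cell, only group-one configurations do), at every `θ` —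
so any such biconditional must carry a thickness / encircling hypothesis. The certificate here is the
smallest instance (`3 × 3` minus centre); the lane's exact enumerations show the same vacuous zero on
`4 × 3`, `4 × 4`, `5 × 3`, `5 × 4`, `6 × 3`, `6 × 4` boxes with a width-one side (HOME notes of the lane).

Sources: the local relation and its one-plaquette groups [cite: GlazmanManolescu2019, Lemma 2.1
(statement)]; [cite: Glazman2015WeightedSAW, Lemma 3.1 (proof: the walks through a rhombus grouped by their
configuration outside it)]; [cite: DuminilCopinSmirnov2012, Lemma 1 (shape of the relation; a ∈ ∂Ω)]; the
general-domain outer-root theorem of the tree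
(`YangBaxterSAWGeneralDomain.vertexFunctional_printed_eq_zero`). Status: CONSOLIDATION (a worked
example of the printed local mechanism on a non-simply-connected domain; negative/positive datum pair
with `PlaquetteWalkHoleRootDefect`); not located in print as a worked example. Kernel-checked with the
standard axioms only; the three enumerations are `decide`d against the tree's `YBWalk`/`termsN`.

Written for the venture lane «pcv-sawmu» (Tier B SEARCH 1; b-engine-1 gen 15).
-/

noncomputable section

namespace Literature.Barriers.CriticalPhenomena.PlaquetteWalk

open Literature.Probability.RandomPlanarGeometry.SAW
open Literature.Probability.RandomPlanarGeometry.SAW.YangBaxter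
open Real Complex

open private vertexFunctional_mul_pow_eq_rowSumN from Literature.Barriers.CriticalPhenomena.PlaquetteWalkSpinRigidity

/-! ### The far cell of the ring and the eight walks that reach it -/

/-- The far cell `(1, 0)` (across the hole from the root) is a face of the ring. [folklore] -/
private theorem farCell_mem_ring8 : ((1 : ℤ), (0 : ℤ)) ∈ ring8 := by
  decide

/-- **Kernel enumeration**: the eight walks of the ring from the hole root that end on a side of the far
cell `(1, 0)` — four down the left column (stop at `W`, cross to `E`, turn out through `S`, turn into the
hole side `N`) and their four right-column images — as cleared terms (slot, counts, `q + 4`). [folklore] -/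
private theorem termsN_ring8_farCell :
    termsN ring8 holeRoot (1, 0) (depth ring8) 4 =
      [⟨2, 1, 2, 1, 0, 0, 7⟩, ⟨3, 1, 3, 1, 0, 0, 6⟩, ⟨1, 2, 2, 1, 0, 0, 8⟩, ⟨0, 1, 2, 2, 0, 0, 7⟩,
       ⟨0, 2, 1, 1, 0, 0, 1⟩, ⟨2, 2, 1, 2, 0, 0, 1⟩, ⟨3, 3, 1, 1, 0, 0, 2⟩, ⟨1, 2, 2, 1, 0, 0, 0⟩] := by
  decide

/-- The one-plaquette ("group one") form of a plaquette entered from its `W` side, cleared by `t`: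
`G_W = c_W t + c_E v t + c_S u₂ + c_N u₁ t²`. [cite: Glazman2015WeightedSAW, Lemma 3.1 (the local linear system)] -/
def groupOneW (W : CWeights) (t : ℂ) (c : Fin 4 → ℂ) : ℂ :=
  c 2 * t + c 0 * W.v * t + c 3 * W.u₂ + c 1 * W.u₁ * t ^ 2

/-- The one-plaquette form of a plaquette entered from its `E` side, cleared by `t`:
`G_E = c_E t + c_W v t + c_S u₁ t² + c_N u₂`. [cite: Glazman2015WeightedSAW, Lemma 3.1 (the local linear system)] -/
def groupOneE (W : CWeights) (t : ℂ) (c : Fin 4 → ℂ) : ℂ :=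
  c 0 * t + c 2 * W.v * t + c 3 * W.u₁ * t ^ 2 + c 1 * W.u₂

/-- **The vertex functional at the far cell of the hole root, for arbitrary weights**:
`F·t⁴ = u₁u₂²v·t⁶·G_W + u₁²u₂v·G_E` — only the two group-one forms, weighted by the two half-ring
paths; no loop term. [cite: GlazmanManolescu2019, §2.1, eq. (2.1)] [cite: DuminilCopinSmirnov2012, Lemma 1 (shape of the relation)] -/
theorem vertexFunctional_ring8_farCell_mul (W : CWeights) {t : ℂ} (ht : t ≠ 0) (c : Fin 4 → ℂ) :
    vertexFunctional W t c ring8 holeRoot (1, 0) * t ^ 4 =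
      W.u₁ * W.u₂ ^ 2 * W.v * t ^ 6 * groupOneW W t c + W.u₁ ^ 2 * W.u₂ * W.v * groupOneE W t c := by
  have hrow := vertexFunctional_mul_pow_eq_rowSumN W ht c ring8 holeRoot (1, 0) 4 (by decide)
  rw [termsN_ring8_farCell] at hrow
  rw [hrow]
  simp only [rowSumN, List.map_cons, List.map_nil, List.sum_cons, List.sum_nil, CWeights.mono, pow_zero,
    pow_one, mul_one, groupOneW, groupOneE]
  ring

/-! ### The group-one forms are the functionals of a single plaquette rooted on its `W` / `E` side -/

/-- The one-face list `[(1, 0)]`. [folklore] -/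
def unitFace : List Face := [((1 : ℤ), (0 : ℤ))]

/-- Kernel enumeration, one plaquette entered from `W`: stop, cross, turn `S`, turn `N`. [folklore] -/
private theorem termsN_unitW :
    termsN unitFace (Face.side (1, 0) .W) (1, 0) (depth unitFace) 1 =
      [⟨2, 0, 0, 0, 0, 0, 1⟩, ⟨0, 0, 0, 1, 0, 0, 1⟩, ⟨3, 0, 1, 0, 0, 0, 0⟩, ⟨1, 1, 0, 0, 0, 0, 2⟩] := by
  decide

/-- Kernel enumeration, one plaquette entered from `E`. [folklore] -/
private theorem termsN_unitE :
    termsN unitFace (Face.side (1, 0) .E) (1, 0) (depth unitFace) 1 =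
      [⟨0, 0, 0, 0, 0, 0, 1⟩, ⟨2, 0, 0, 1, 0, 0, 1⟩, ⟨3, 1, 0, 0, 0, 0, 2⟩, ⟨1, 0, 1, 0, 0, 0, 0⟩] := by
  decide

/-- `F_{[(1,0)]}(W side; (1,0)) · t = G_W`. [cite: Glazman2015WeightedSAW, Lemma 3.1 (the local linear system)] -/
theorem vertexFunctional_unitW_mul (W : CWeights) {t : ℂ} (ht : t ≠ 0) (c : Fin 4 → ℂ) :
    vertexFunctional W t c unitFace (Face.side (1, 0) .W) (1, 0) * t ^ 1 = groupOneW W t c := by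
  have hrow := vertexFunctional_mul_pow_eq_rowSumN W ht c unitFace (Face.side (1, 0) .W) (1, 0) 1 (by decide)
  rw [termsN_unitW] at hrow
  rw [hrow]
  simp only [rowSumN, List.map_cons, List.map_nil, List.sum_cons, List.sum_nil, CWeights.mono, pow_zero,
    pow_one, mul_one, one_mul, groupOneW]
  ring

/-- `F_{[(1,0)]}(E side; (1,0)) · t = G_E`. [cite: Glazman2015WeightedSAW, Lemma 3.1 (the local linear system)] -/
theorem vertexFunctional_unitE_mul (W : CWeights) {t : ℂ} (ht : t ≠ 0) (c : Fin 4 → ℂ) :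
    vertexFunctional W t c unitFace (Face.side (1, 0) .E) (1, 0) * t ^ 1 = groupOneE W t c := by
  have hrow := vertexFunctional_mul_pow_eq_rowSumN W ht c unitFace (Face.side (1, 0) .E) (1, 0) 1 (by decide)
  rw [termsN_unitE] at hrow
  rw [hrow]
  simp only [rowSumN, List.map_cons, List.map_nil, List.sum_cons, List.sum_nil, CWeights.mono, pow_zero,
    pow_one, mul_one, one_mul, groupOneE]
  ring

/-- The `W` side of a single plaquette is an outer root (its exterior face `(0, 0)` is beyond the list:
a chain of length `0`). [cite: GlazmanManolescu2019, §2.1 (walks start on the outer boundary)] -/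
theorem outerRoot_unitW : OuterRoot (dom unitFace) (Face.side (1, 0) .W) :=
  ⟨0, fun _ => ((0 : ℤ), (0 : ℤ)), ⟨.E, by decide⟩, fun i _ h => by simp [dom, unitFace] at h,
    fun i hi => absurd hi (Nat.not_lt_zero _), Or.inl fun f hf => by simp [dom, unitFace] at hf; subst hf; decide⟩

/-- The `E` side of a single plaquette is an outer root (exterior face `(2, 0)`). [cite: GlazmanManolescu2019, §2.1 (walks start on the outer boundary)] -/
theorem outerRoot_unitE : OuterRoot (dom unitFace) (Face.side (1, 0) .E) :=
  ⟨0, fun _ => ((2 : ℤ), (0 : ℤ)), ⟨.W, by decide⟩, fun i _ h => by simp [dom, unitFace] at h,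
    fun i hi => absurd hi (Nat.not_lt_zero _), Or.inr (Or.inl fun f hf => by simp [dom, unitFace] at hf; subst hf; decide)⟩

/-- A single plaquette is a face of its own list. [folklore] -/
private theorem face_mem_unitFace : ((1 : ℤ), (0 : ℤ)) ∈ unitFace := by
  decide

/-- **The `W`-entry group-one form vanishes at the printed weights**, every `θ ∈ [π/3, 2π/3]` (Lemma 2.1
on the one-face list, outer root `W`). [cite: GlazmanManolescu2019, Lemma 2.1, eq. (2.2) (CR)] -/
theorem groupOneW_printed_eq_zero {θ : ℝ} (hθ : θ ∈ Set.Icc (π / 3) (2 * π / 3)) :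
    groupOneW (printedWeights θ) tFiveEighths (ybCoeff θ) = 0 := by
  rw [← vertexFunctional_unitW_mul _ tFiveEighths_ne_zero,
    vertexFunctional_printed_eq_zero hθ unitFace _ outerRoot_unitW (1, 0) face_mem_unitFace, zero_mul]

/-- **The `E`-entry group-one form vanishes at the printed weights**, every `θ ∈ [π/3, 2π/3]`.
[cite: GlazmanManolescu2019, Lemma 2.1, eq. (2.2) (CR)] -/
theorem groupOneE_printed_eq_zero {θ : ℝ} (hθ : θ ∈ Set.Icc (π / 3) (2 * π / 3)) :
    groupOneE (printedWeights θ) tFiveEighths (ybCoeff θ) = 0 := by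
  rw [← vertexFunctional_unitE_mul _ tFiveEighths_ne_zero,
    vertexFunctional_printed_eq_zero hθ unitFace _ outerRoot_unitE (1, 0) face_mem_unitFace, zero_mul]

/-! ### The far-cell zero -/

/-- ★ **At the far cell of the hole root the printed Yang–Baxter weights DO satisfy the vertex relation**,
for every `θ ∈ [π/3, 2π/3]`: `Σ_s c_s(θ) F_{ring8}(holeRoot → z_s((1,0))) = 0` — a vacuous zero (only
group-one configurations reach the far cell), in contrast with the defect at the root plaquette
(`vertexFunctional_printed_ring8_ne_zero`). [cite: GlazmanManolescu2019, Lemma 2.1 (the local mechanism)] -/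
theorem vertexFunctional_printed_ring8_farCell_eq_zero {θ : ℝ} (hθ : θ ∈ Set.Icc (π / 3) (2 * π / 3)) :
    vertexFunctional (printedWeights θ) tFiveEighths (ybCoeff θ) ring8 holeRoot (1, 0) = 0 := by
  have key := vertexFunctional_ring8_farCell_mul (printedWeights θ) tFiveEighths_ne_zero (ybCoeff θ)
  rw [groupOneW_printed_eq_zero hθ, groupOneE_printed_eq_zero hθ, mul_zero, mul_zero, add_zero] at key
  exact (mul_eq_zero.1 key).resolve_right (pow_ne_zero 4 tFiveEighths_ne_zero)

/-- **The hole root of the ring: defect at the root plaquette, none at the far cell** (`θ = π/3`, where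
both are tree theorems). [cite: GlazmanManolescu2019, Lemma 2.1] -/
theorem vertexFunctional_printed_ring8_root_ne_farCell_eq :
    vertexFunctional (printedWeights (π / 3)) tFiveEighths (ybCoeff (π / 3)) ring8 holeRoot (1, 2) ≠ 0 ∧
      vertexFunctional (printedWeights (π / 3)) tFiveEighths (ybCoeff (π / 3)) ring8 holeRoot (1, 0) = 0 :=
  ⟨vertexFunctional_printed_ring8_ne_zero,
    vertexFunctional_printed_ring8_farCell_eq_zero ⟨le_rfl, by linarith [Real.pi_pos]⟩⟩

/-! ### Listing-independence: the same zero for the row-major listing of the ring -/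

/-- A sum over the walks of a domain does not depend on the `Fintype` instance used, nor on how
the (equal) domain is presented. [folklore] -/
private theorem sum_YBWalk_congr {D D' : Set Face} (h : D = D') (a z : MidEdge)
    [i : Fintype (YBWalk D a z)] [i' : Fintype (YBWalk D' a z)] (g : List MidEdge → ℂ) :
    ∑ γ : YBWalk D a z, g γ.mids = ∑ γ : YBWalk D' a z, g γ.mids := by
  subst h
  have hi : i = i' := Subsingleton.elim _ _
  subst hi
  rfl

/-- The vertex functional depends on the face list only through its face set (the walks live in
`dom Dl`). [cite: GlazmanManolescu2019, §2.1, eq. (2.1) (the observable of a domain)] -/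
theorem vertexFunctional_congr_dom {Dl Dl' : List Face} (h : dom Dl = dom Dl') (W : CWeights) (t : ℂ)
    (c : Fin 4 → ℂ) (a : MidEdge) (f₀ : Face) :
    vertexFunctional W t c Dl a f₀ = vertexFunctional W t c Dl' a f₀ := by
  unfold vertexFunctional gmObservable
  refine Finset.sum_congr rfl fun s _ => ?_
  congr 1
  exact sum_YBWalk_congr h a (slotSide f₀ s) (fun l => weightL W l * t ^ quarterTurnsL l)

/-- The row-major listing `{0,1,2} × {0,1,2} ∖ {(1,1)}` of the same ring (the order produced by box
enumerations). [folklore] -/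
def ring8RowMajor : List Face := [(0, 0), (0, 1), (0, 2), (1, 0), (1, 2), (2, 0), (2, 1), (2, 2)]

/-- The two listings have the same face set. [folklore] -/
private theorem dom_ring8RowMajor : dom ring8RowMajor = dom ring8 := by
  ext f
  simp only [dom, Set.mem_setOf_eq, ring8RowMajor, ring8, List.mem_cons, List.not_mem_nil, or_false]
  tauto

/-- ★ The far-cell zero for the row-major listing, root written as `Face.side (1,1) .N`, every
`θ ∈ [π/3, 2π/3]`. [cite: GlazmanManolescu2019, Lemma 2.1 (the local mechanism)] -/
theorem vertexFunctional_printed_ring8RowMajor_farCell_eq_zero {θ : ℝ} (hθ : θ ∈ Set.Icc (π / 3) (2 * π / 3)) :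
    vertexFunctional (printedWeights θ) tFiveEighths (ybCoeff θ) ring8RowMajor (Face.side (1, 1) .N) (1, 0) = 0 := by
  rw [vertexFunctional_congr_dom dom_ring8RowMajor]
  exact vertexFunctional_printed_ring8_farCell_eq_zero hθ

/-- Named statement **`PlaquetteWalkHoleRootFarCellZero`**: on the `3 × 3` block minus its centre,
rooted on the hole at `holeRoot`, the printed Yang–Baxter weights with coefficients `(1, r(θ), −1, −r(θ))`
satisfy the vertex relation at the far cell `(1, 0)` for every `θ ∈ [π/3, 2π/3]`.
[cite: GlazmanManolescu2019, Lemma 2.1 (the local mechanism)] -/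
def PlaquetteWalkHoleRootFarCellZero : Prop :=
  ∀ θ ∈ Set.Icc (π / 3) (2 * π / 3),
    vertexFunctional (printedWeights θ) tFiveEighths (ybCoeff θ) ring8 holeRoot (1, 0) = 0

/-- `PlaquetteWalkHoleRootFarCellZero` holds. [cite: GlazmanManolescu2019, Lemma 2.1 (the local mechanism)] -/
theorem PlaquetteWalkHoleRootFarCellZero_holds : PlaquetteWalkHoleRootFarCellZero :=
  fun _ hθ => vertexFunctional_printed_ring8_farCell_eq_zero hθ

/-! ## Appendix (edition 4): the thin BOX `4 × 3` minus `(1, 1)` — a vacuous far-cell zero WITHOUT mirror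
symmetry

The row-major box `{0,1,2,3} × {0,1,2} ∖ {(1,1)}` (a single-hole box in the sense of the lane's census: the
hole is strictly inside), rooted on the hole at the `N` side of `(1, 1)`; far cell `(1, 0)`. The reflection
`x ↦ 2 − x` fixing the root is NOT a symmetry of the box (`(3, 0) ↦ (−1, 0)`), yet the far-cell functional
vanishes for every `θ`: the twenty walks reaching a side of the far cell are again group-one configurations
only (one left prefix, four right prefixes through the `2 × 3` block `{2,3} × {0,1,2}`), so
`F·t⁴ = u₁u₂²v·t⁶·G_W + u₁²u₂v·(1 + v² + u₂² + u₁²)·G_E`. This is the in-kernel form of the lane's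
exact-arithmetic cell «4×3∖(1,1), root N, θ = π/2: zero, not mirror-symmetric» (b-engine-1 g15, 13:14Z;
b-ref g61 readback). The two enumerations on the eleven-face list are checked by `decide +kernel` (kernel
reduction, standard axioms). -/

/-- The `4 × 3` box minus `(1, 1)`, row-major. [folklore] -/
def box43 : List Face :=
  [(0, 0), (0, 1), (0, 2), (1, 0), (1, 2), (2, 0), (2, 1), (2, 2), (3, 0), (3, 1), (3, 2)]

/-- The reflection `x ↦ 2 − x` through the root is not a symmetry of `box43`. [folklore] -/
private theorem box43_not_mirror_symmetric : ¬ ∀ f ∈ box43, ((2 : ℤ) - f.1, f.2) ∈ box43 := by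
  decide

/-- The far cell `(1, 0)` is a face of `box43` and the hole `(1, 1)` is not. [folklore] -/
private theorem farCell_mem_box43 : ((1 : ℤ), (0 : ℤ)) ∈ box43 ∧ ((1 : ℤ), (1 : ℤ)) ∉ box43 := by
  decide

/-- **Kernel enumeration**: the twenty walks of `box43` from the hole root that end on a side of the far
cell — one left prefix and four right prefixes, each followed by stop / cross / turn `S` / turn `N`.
[folklore] -/
private theorem termsN_box43_farCell :
    termsN box43 (Face.side (1, 1) .N) (1, 0) (depth box43) 4 =
      [⟨2, 1, 2, 1, 0, 0, 7⟩, ⟨3, 1, 3, 1, 0, 0, 6⟩, ⟨1, 2, 2, 1, 0, 0, 8⟩, ⟨0, 1, 2, 2, 0, 0, 7⟩,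
       ⟨0, 2, 1, 1, 0, 0, 1⟩, ⟨2, 2, 1, 2, 0, 0, 1⟩, ⟨3, 3, 1, 1, 0, 0, 2⟩, ⟨1, 2, 2, 1, 0, 0, 0⟩,
       ⟨0, 2, 3, 1, 0, 0, 1⟩, ⟨2, 2, 3, 2, 0, 0, 1⟩, ⟨3, 3, 3, 1, 0, 0, 2⟩, ⟨1, 2, 4, 1, 0, 0, 0⟩,
       ⟨0, 4, 1, 1, 0, 0, 1⟩, ⟨2, 4, 1, 2, 0, 0, 1⟩, ⟨3, 5, 1, 1, 0, 0, 2⟩, ⟨1, 4, 2, 1, 0, 0, 0⟩,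
       ⟨0, 2, 1, 3, 0, 0, 1⟩, ⟨2, 2, 1, 4, 0, 0, 1⟩, ⟨3, 3, 1, 3, 0, 0, 2⟩, ⟨1, 2, 2, 3, 0, 0, 0⟩] := by
  decide +kernel

/-- **The far-cell functional of the thin box, arbitrary weights**:
`F·t⁴ = u₁u₂²v·t⁶·G_W + u₁²u₂v·(1 + v² + u₂² + u₁²)·G_E` — group-one forms only, no loop term.
[cite: GlazmanManolescu2019, §2.1, eq. (2.1)] [cite: DuminilCopinSmirnov2012, Lemma 1 (shape of the relation)] -/
theorem vertexFunctional_box43_farCell_mul (W : CWeights) {t : ℂ} (ht : t ≠ 0) (c : Fin 4 → ℂ) :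
    vertexFunctional W t c box43 (Face.side (1, 1) .N) (1, 0) * t ^ 4 =
      W.u₁ * W.u₂ ^ 2 * W.v * t ^ 6 * groupOneW W t c +
      W.u₁ ^ 2 * W.u₂ * W.v * (1 + W.v ^ 2 + W.u₂ ^ 2 + W.u₁ ^ 2) * groupOneE W t c := by
  have hrow := vertexFunctional_mul_pow_eq_rowSumN W ht c box43 (Face.side (1, 1) .N) (1, 0) 4 (by decide +kernel)
  rw [termsN_box43_farCell] at hrow
  rw [hrow]
  simp only [rowSumN, List.map_cons, List.map_nil, List.sum_cons, List.sum_nil, CWeights.mono, pow_zero,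
    pow_one, mul_one, groupOneW, groupOneE]
  ring

/-- ★ **A vacuous far-cell zero without mirror symmetry**: on the thin box `box43`, rooted on the hole at
the `N` side of `(1, 1)`, the printed Yang–Baxter weights satisfy the vertex relation at the far cell
`(1, 0)` for every `θ ∈ [π/3, 2π/3]`, although the reflection through the root is not a symmetry of the
box (`box43_not_mirror_symmetric`). [cite: GlazmanManolescu2019, Lemma 2.1 (the local mechanism)] -/
theorem vertexFunctional_printed_box43_farCell_eq_zero {θ : ℝ} (hθ : θ ∈ Set.Icc (π / 3) (2 * π / 3)) :
    vertexFunctional (printedWeights θ) tFiveEighths (ybCoeff θ) box43 (Face.side (1, 1) .N) (1, 0) = 0 := by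
  have key := vertexFunctional_box43_farCell_mul (printedWeights θ) tFiveEighths_ne_zero (ybCoeff θ)
  rw [groupOneW_printed_eq_zero hθ, groupOneE_printed_eq_zero hθ, mul_zero, mul_zero, add_zero] at key
  exact (mul_eq_zero.1 key).resolve_right (pow_ne_zero 4 tFiveEighths_ne_zero)

end Literature.Barriers.CriticalPhenomena.PlaquetteWalk

end
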